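import Summits.QuantumFields.YangMills.Theorems.SwapVirialDeficitBlowUpChartDeficitGrowth
import Summits.QuantumFields.YangMills.Theorems.SwapVirialDeficitSwapRingCeilingBoxTwisted
import HarnessLib

/-!
# W8, first input: the SECTOR-`z` chart box and growth — every sector's chart deficit controls the followers (`48L³√F̂_z`) and the SIGNED σ-relations (`52L³√F̂_z`)
# in w2 g57's ring chart with the sector character `χ_z(x) = centreElem(π_z(x))` (free-hands support of ⟨stmt-QuantumFields-24197⟩; twin of ✓`chartBox_of_chartDeficit` ∕
# ✓`…ChartDeficitGrowth` for the MINUS sector `001` of LEAD ym-line-sfw-p2 g97's sector-wise Morse–Bott plan, brick W8)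

LEAD g97's ✓`swapGluedStiffness_of_sharpSectorLaplace` runs the Morse–Bott programme VALLEY BY VALLEY (`z = 000` and `z = 001`); its sector-`001` twin needs the same
tree-side floors as the principal sector.  w2 g54's ring-level SIGNED box ✓`SwapRingTwisted.swapCommBox_of_swapRingDeficit_twisted` (every `z`) compares the seam field with
`centreElem(π_z(x))·c`; read in the ring chart `q = (C,U) ↦ fixHistory (ringConfig χ_z q)` with the SECTOR CHARACTER
`χ_z(x) := centreElem ((z 0 && x₀ ≠ 0) ⊻ (z 1 && x₁ ≠ 0) ⊻ (z 2 && x₂ ≠ 0))` (central), the followers are again EXACTLY the relative box coordinates: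

* ★★ `chartBox_of_chartDeficit_twisted (z) (q)` — `‖[C_μ,C_ν]‖_F ≤ 52L³√F̂_z`, `‖c·C_{σμ} − centreElem(z μ)·C_μ·c‖_F ≤ 52L³√F̂_z`, `‖U_i − 1‖_F ≤ 48L³√F̂_z` (EVERY `i : Fol L`),
  with `F̂_z = chartDeficit L z χ_z q`;
* ★★ `sum_follower_frobNorm_sq_le_chartDeficit_twisted` (`Σ_i‖U_i − 1‖²_F ≤ 2304·L⁶·|Fol L|·F̂_z`: the hub-angle-independent follower growth in EVERY sector),
  `follower_frobNorm_sq_le_chartDeficit_twisted`, ★ `signedRelations_sq_sum_le_chartDeficit_twisted` (`Σ‖[C_μ,C_ν]‖² + Σ‖cC_{σμ} − centreElem(z μ)C_μc‖² ≤ 32448·L⁶·F̂_z`),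
  ★ `chartDeficit_twisted_ge_of_follower_far` (separation `R²/(2304L⁶) ≤ F̂_z`).
For `z = 001` the signed relations read `cC₁ ≈ C₀c`, `cC₀ ≈ C₁c`, `cC₂ ≈ −C₂c` (the minus valley: `h₁ = h₀⁻¹`-type stratum with `tr h₂ = 0`).

HONEST LABEL: bookkeeping (a landed ring-level inequality read in the chart); the 001 Taylor data, tip and assembly are not here; ⟨24197⟩ ∕ ⟨24196⟩ ∕ ⟨24194⟩ ∕ ⟨24497⟩ OPEN;
own crux ⟨22884⟩ OPEN (blocked-on ⟨19935⟩); no crux, rung of record or summit is proved; the Yang–Mills mass gap is NOT proved; no summit is proved by a line.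
THEOREMS ONLY (0 `def`, 0 `sorry`), standard axioms.  Width seat ym-line-sfw-p2-w3 g65 (cell ym-idea-1, free hands), `--supports stmt-QuantumFields-24197`.
References: [cite: tHooft1979]; [cite: Luscher1983, §2]; [folklore].
-/

set_option autoImplicit false

noncomputable section

open MeasureTheory
open scoped BigOperators
open Literature.MathematicalPhysics.QuantumFieldTheory hiding SU2
open Literature.MathematicalPhysics.QuantumLattice

namespace Summit.QuantumFields.YangMills.Theorems.SwapVirialDeficit.BlowUpRing

open Summit.QuantumFields.YangMills.Theorems.FemtoTransferGap
open Summit.QuantumFields.YangMills.Theorems.FemtoTransferGap.TT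
open Summit.QuantumFields.YangMills.Theorems.VirialFluxGap.RingDeficit
open Summit.QuantumFields.YangMills.Theorems.SwapTwistDeficit.PeriodicRingFloor
open Summit.QuantumFields.YangMills.Theorems.SwapVirialDeficit.SwapRing
open Summit.QuantumFields.YangMills.Theorems.SwapVirialDeficit.SwapRingTwisted (swapCommBox_of_swapRingDeficit_twisted)

variable {L : ℕ} [NeZero L]

/-- ★★ **THE SECTOR-`z` CHART BOX**: for every sector `z` and every chart point `q = (C, U)`, with the sector character
`χ_z x = centreElem ((z 0 && x 0 ≠ 0) ⊻ ((z 1 && x 1 ≠ 0) ⊻ (z 2 && x 2 ≠ 0)))` and `F̂_z = chartDeficit L z χ_z q`: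
pairwise leader commutators `≤ 52L³√F̂_z`, SIGNED σ-relations `‖c·C_{σμ} − centreElem(z μ)·C_μ·c‖_F ≤ 52L³√F̂_z`, and EVERY follower `‖U_i − 1‖_F ≤ 48L³√F̂_z`
(✓`swapCommBox_of_swapRingDeficit_twisted` in the ring chart). [cite: tHooft1979] [cite: Luscher1983, §2] -/
theorem chartBox_of_chartDeficit_twisted (z : Fin 3 → Bool) (q : (Fin 4 → SU2) × (Fol L → SU2)) :
    (∀ μ ν : Fin 3, frobNorm (((q.1 (Fin.castSucc μ) * q.1 (Fin.castSucc ν) : SU2) : Matrix (Fin 2) (Fin 2) ℂ) -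
        ((q.1 (Fin.castSucc ν) * q.1 (Fin.castSucc μ) : SU2) : Matrix (Fin 2) (Fin 2) ℂ)) ≤
      52 * (L : ℝ) ^ 3 * Real.sqrt (chartDeficit L z
        (fun x => centreElem (Bool.xor (z 0 && decide (x 0 ≠ 0)) (Bool.xor (z 1 && decide (x 1 ≠ 0)) (z 2 && decide (x 2 ≠ 0))))) q)) ∧
    (∀ μ : Fin 3, frobNorm (((q.1 (Fin.last 3) * q.1 (Fin.castSucc (Equiv.swap (0 : Fin 3) 1 μ)) : SU2) : Matrix (Fin 2) (Fin 2) ℂ) -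
        ((centreElem (z μ) * q.1 (Fin.castSucc μ) * q.1 (Fin.last 3) : SU2) : Matrix (Fin 2) (Fin 2) ℂ)) ≤
      52 * (L : ℝ) ^ 3 * Real.sqrt (chartDeficit L z
        (fun x => centreElem (Bool.xor (z 0 && decide (x 0 ≠ 0)) (Bool.xor (z 1 && decide (x 1 ≠ 0)) (z 2 && decide (x 2 ≠ 0))))) q)) ∧
    (∀ i : Fol L, frobNorm (((q.2 i : SU2) : Matrix (Fin 2) (Fin 2) ℂ) - 1) ≤
      48 * (L : ℝ) ^ 3 * Real.sqrt (chartDeficit L z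
        (fun x => centreElem (Bool.xor (z 0 && decide (x 0 ≠ 0)) (Bool.xor (z 1 && decide (x 1 ≠ 0)) (z 2 && decide (x 2 ≠ 0))))) q)) := by
  set χ : Site 3 L → SU2 := fun x => centreElem (Bool.xor (z 0 && decide (x 0 ≠ 0)) (Bool.xor (z 1 && decide (x 1 ≠ 0)) (z 2 && decide (x 2 ≠ 0))))
    with hχ
  obtain ⟨hCC, hcC, hw, hr, hg⟩ := swapCommBox_of_swapRingDeficit_twisted (L := L) z (ringConfig χ q).1 (ringConfig χ q).2.1 (ringConfig χ q).2.2
  have hF : swapRingDeficit L z ((Fin.cons (glue (ringConfig χ q).1) (ringConfig χ q).2.1 : Fin (2 * L - 1 + 1) → GaugeConfig 3 L SU2), (ringConfig χ q).2.2) =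
      chartDeficit L z χ q := rfl
  simp only [hF, ringConfig_fst_lead, ringConfig_snd_snd_zero] at hCC hcC hw hr hg
  refine ⟨hCC, hcC, fun i => ?_⟩
  rcases i with i | ⟨j, e⟩ | x
  · have h := hw i.1
    rw [ringConfig_fst_of_not_isLead] at h
    have hl : (if i.1.1.1 i.1.1.2 = -1 then q.1 (Fin.castSucc i.1.1.2) else 1) = letter (fun μ => q.1 (Fin.castSucc μ)) i.1 := rfl
    rwa [hl, inv_mul_cancel_left] at h
  · have h := hr j e
    rwa [ringConfig_snd_fst, inv_mul_cancel_left] at h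
  · have h := hg x.1
    have e1 : (ringConfig χ q).2.2 x.1 = χ x.1 * q.1 (Fin.last 3) * q.2 (Sum.inr (Sum.inr x)) := ringConfig_snd_snd_of_ne χ q x
    rw [e1] at h
    have e2 : χ x.1 = centreElem (Bool.xor (z 0 && decide (x.1 0 ≠ 0)) (Bool.xor (z 1 && decide (x.1 1 ≠ 0)) (z 2 && decide (x.1 2 ≠ 0)))) := rfl
    rwa [← e2, inv_mul_cancel_left] at h

/-- ★ Per-follower growth in sector `z`: `‖U_i − 1‖²_F ≤ 2304·L⁶·F̂_z`. [cite: Luscher1983, §2] -/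
theorem follower_frobNorm_sq_le_chartDeficit_twisted (z : Fin 3 → Bool) (q : (Fin 4 → SU2) × (Fol L → SU2)) (i : Fol L) :
    frobNorm (((q.2 i : SU2) : Matrix (Fin 2) (Fin 2) ℂ) - 1) ^ 2 ≤ 2304 * (L : ℝ) ^ 6 * chartDeficit L z
      (fun x => centreElem (Bool.xor (z 0 && decide (x 0 ≠ 0)) (Bool.xor (z 1 && decide (x 1 ≠ 0)) (z 2 && decide (x 2 ≠ 0))))) q := by
  obtain ⟨-, -, hU⟩ := chartBox_of_chartDeficit_twisted (L := L) z q
  have hF := chartDeficit_nonneg z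
    (fun x => centreElem (Bool.xor (z 0 && decide (x 0 ≠ 0)) (Bool.xor (z 1 && decide (x 1 ≠ 0)) (z 2 && decide (x 2 ≠ 0))))) q
  have h := sq_le_sq_mul_of_le_mul_sqrt (frobNorm_nonneg _) hF (hU i)
  calc _ ≤ (48 * (L : ℝ) ^ 3) ^ 2 * _ := h
    _ = _ := by ring

/-- ★★ **FOLLOWER GROWTH IN EVERY SECTOR**: `Σ_i ‖U_i − 1‖²_F ≤ 2304·L⁶·|Fol L|·F̂_z(C,U)` — hub-angle independent, every leader tuple (the `001` twin of
✓`sum_follower_frobNorm_sq_le_chartDeficit`, input (M2)(a) ∕ W8 for the minus valley). [cite: Luscher1983, §2] -/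
theorem sum_follower_frobNorm_sq_le_chartDeficit_twisted (z : Fin 3 → Bool) (q : (Fin 4 → SU2) × (Fol L → SU2)) :
    ∑ i : Fol L, frobNorm (((q.2 i : SU2) : Matrix (Fin 2) (Fin 2) ℂ) - 1) ^ 2 ≤
      2304 * (L : ℝ) ^ 6 * (Fintype.card (Fol L) : ℝ) * chartDeficit L z
        (fun x => centreElem (Bool.xor (z 0 && decide (x 0 ≠ 0)) (Bool.xor (z 1 && decide (x 1 ≠ 0)) (z 2 && decide (x 2 ≠ 0))))) q := by
  calc ∑ i : Fol L, frobNorm (((q.2 i : SU2) : Matrix (Fin 2) (Fin 2) ℂ) - 1) ^ 2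
      ≤ ∑ _i : Fol L, 2304 * (L : ℝ) ^ 6 * chartDeficit L z
          (fun x => centreElem (Bool.xor (z 0 && decide (x 0 ≠ 0)) (Bool.xor (z 1 && decide (x 1 ≠ 0)) (z 2 && decide (x 2 ≠ 0))))) q :=
        Finset.sum_le_sum fun i _ => follower_frobNorm_sq_le_chartDeficit_twisted z q i
    _ = _ := by rw [Finset.sum_const, Finset.card_univ, nsmul_eq_mul]; ring

/-- ★ **GROWTH IN THE SIGNED RELATION ENERGY** (sector `z`): `Σ_{μ,ν}‖[C_μ,C_ν]‖²_F + Σ_μ‖c·C_{σμ} − centreElem(z μ)·C_μ·c‖²_F ≤ 32448·L⁶·F̂_z` (`12 × 2704`).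
[cite: tHooft1979] [cite: Luscher1983, §2] -/
theorem signedRelations_sq_sum_le_chartDeficit_twisted (z : Fin 3 → Bool) (q : (Fin 4 → SU2) × (Fol L → SU2)) :
    (∑ μ : Fin 3, ∑ ν : Fin 3, frobNorm (((q.1 (Fin.castSucc μ) * q.1 (Fin.castSucc ν) : SU2) : Matrix (Fin 2) (Fin 2) ℂ) -
        ((q.1 (Fin.castSucc ν) * q.1 (Fin.castSucc μ) : SU2) : Matrix (Fin 2) (Fin 2) ℂ)) ^ 2) +
      ∑ μ : Fin 3, frobNorm (((q.1 (Fin.last 3) * q.1 (Fin.castSucc (Equiv.swap (0 : Fin 3) 1 μ)) : SU2) : Matrix (Fin 2) (Fin 2) ℂ) -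
        ((centreElem (z μ) * q.1 (Fin.castSucc μ) * q.1 (Fin.last 3) : SU2) : Matrix (Fin 2) (Fin 2) ℂ)) ^ 2 ≤
      32448 * (L : ℝ) ^ 6 * chartDeficit L z
        (fun x => centreElem (Bool.xor (z 0 && decide (x 0 ≠ 0)) (Bool.xor (z 1 && decide (x 1 ≠ 0)) (z 2 && decide (x 2 ≠ 0))))) q := by
  obtain ⟨hC, hσ, -⟩ := chartBox_of_chartDeficit_twisted (L := L) z q
  set F : ℝ := chartDeficit L z
    (fun x => centreElem (Bool.xor (z 0 && decide (x 0 ≠ 0)) (Bool.xor (z 1 && decide (x 1 ≠ 0)) (z 2 && decide (x 2 ≠ 0))))) q with hFdef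
  have hF : 0 ≤ F := chartDeficit_nonneg z _ q
  have h1 : ∀ μ ν : Fin 3, frobNorm (((q.1 (Fin.castSucc μ) * q.1 (Fin.castSucc ν) : SU2) : Matrix (Fin 2) (Fin 2) ℂ) -
      ((q.1 (Fin.castSucc ν) * q.1 (Fin.castSucc μ) : SU2) : Matrix (Fin 2) (Fin 2) ℂ)) ^ 2 ≤ 2704 * (L : ℝ) ^ 6 * F := fun μ ν => by
    have h := sq_le_sq_mul_of_le_mul_sqrt (frobNorm_nonneg _) hF (hC μ ν)
    calc _ ≤ (52 * (L : ℝ) ^ 3) ^ 2 * F := h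
      _ = _ := by ring
  have h2 : ∀ μ : Fin 3, frobNorm (((q.1 (Fin.last 3) * q.1 (Fin.castSucc (Equiv.swap (0 : Fin 3) 1 μ)) : SU2) : Matrix (Fin 2) (Fin 2) ℂ) -
      ((centreElem (z μ) * q.1 (Fin.castSucc μ) * q.1 (Fin.last 3) : SU2) : Matrix (Fin 2) (Fin 2) ℂ)) ^ 2 ≤ 2704 * (L : ℝ) ^ 6 * F := fun μ => by
    have h := sq_le_sq_mul_of_le_mul_sqrt (frobNorm_nonneg _) hF (hσ μ)
    calc _ ≤ (52 * (L : ℝ) ^ 3) ^ 2 * F := h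
      _ = _ := by ring
  have s1 : ∑ μ : Fin 3, ∑ ν : Fin 3, frobNorm (((q.1 (Fin.castSucc μ) * q.1 (Fin.castSucc ν) : SU2) : Matrix (Fin 2) (Fin 2) ℂ) -
        ((q.1 (Fin.castSucc ν) * q.1 (Fin.castSucc μ) : SU2) : Matrix (Fin 2) (Fin 2) ℂ)) ^ 2 ≤ ∑ _μ : Fin 3, ∑ _ν : Fin 3, 2704 * (L : ℝ) ^ 6 * F :=
    Finset.sum_le_sum fun μ _ => Finset.sum_le_sum fun ν _ => h1 μ ν
  have s2 : ∑ μ : Fin 3, frobNorm (((q.1 (Fin.last 3) * q.1 (Fin.castSucc (Equiv.swap (0 : Fin 3) 1 μ)) : SU2) : Matrix (Fin 2) (Fin 2) ℂ) -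
        ((centreElem (z μ) * q.1 (Fin.castSucc μ) * q.1 (Fin.last 3) : SU2) : Matrix (Fin 2) (Fin 2) ℂ)) ^ 2 ≤ ∑ _μ : Fin 3, 2704 * (L : ℝ) ^ 6 * F :=
    Finset.sum_le_sum fun μ _ => h2 μ
  simp only [Finset.sum_const, Finset.card_univ, Fintype.card_fin, nsmul_eq_mul, Nat.cast_ofNat] at s1 s2
  linarith

/-- ★ **Separation in a follower direction, every sector**: `0 ≤ R ≤ ‖U_i − 1‖_F ⟹ R²/(2304·L⁶) ≤ F̂_z(C,U)`. [cite: Luscher1983, §2] -/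
theorem chartDeficit_twisted_ge_of_follower_far (z : Fin 3 → Bool) (q : (Fin 4 → SU2) × (Fol L → SU2)) (i : Fol L) {R : ℝ} (hR : 0 ≤ R)
    (hfar : R ≤ frobNorm (((q.2 i : SU2) : Matrix (Fin 2) (Fin 2) ℂ) - 1)) :
    R ^ 2 / (2304 * (L : ℝ) ^ 6) ≤ chartDeficit L z
      (fun x => centreElem (Bool.xor (z 0 && decide (x 0 ≠ 0)) (Bool.xor (z 1 && decide (x 1 ≠ 0)) (z 2 && decide (x 2 ≠ 0))))) q := by
  obtain ⟨-, -, hU⟩ := chartBox_of_chartDeficit_twisted (L := L) z q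
  have hL : (0 : ℝ) < L := by exact_mod_cast NeZero.pos L
  have h := div_sq_le_of_le_of_le_mul_sqrt hR (by positivity : (0 : ℝ) < 48 * (L : ℝ) ^ 3) (chartDeficit_nonneg z _ q) hfar (hU i)
  calc R ^ 2 / (2304 * (L : ℝ) ^ 6) = R ^ 2 / (48 * (L : ℝ) ^ 3) ^ 2 := by ring
    _ ≤ _ := h

end Summit.QuantumFields.YangMills.Theorems.SwapVirialDeficit.BlowUpRing

end
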